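import Mathlib
import Literature.Geometry.Symplectic.JHolomorphicMap
import Summits.SmoothPoincare4.SmoothPoincare4.Theorems.SullivanDualTameOrBrodyR4AprioriBootstrap
import Summits.SmoothPoincare4.SmoothPoincare4.Theorems.SullivanDualTameOrBrodyR4AprioriBeta
import Summits.SmoothPoincare4.SmoothPoincare4.Theorems.SullivanDualTameOrBrodyR4AprioriGamma
import Summits.SmoothPoincare4.SmoothPoincare4.Theorems.SullivanDualTameOrBrodyR4StubLadyzhenskaya
import Summits.SmoothPoincare4.SmoothPoincare4.Theorems.SullivanDualTameOrBrodyR4StubSupBound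
import Summits.SmoothPoincare4.SmoothPoincare4.Theorems.SullivanDualTameOrBrodyR4StubNormIteratedFDerivLe

/-!
# Stub `helper_aprioriLocal_of` of line `Sketch` for crux `WitnessCharge`
(stmt-SmoothPoincare4-7824, route SullivanDual)

Localisation of the landed a-priori chain of the sibling crux `TameOrBrodyR4`: the bootstrapping
induction `Apriori.bootstrap` (`…TameOrBrodyR4AprioriBootstrap`) and the final estimate
`stub_aprioriOf` (`…TameOrBrodyR4StubAprioriOf`) are copied verbatim, with the global flat
`J`-holomorphicity `IsJHolomorphicFlat J g` replaced by the equation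
`dg(z)(iζ) = J(g z)(dg(z) ζ)` on the open disc of radius `2`, and with the step `α`
(`Apriori.alpha`, the only step consuming the equation) replaced by its LOCAL form, taken as a
hypothesis (it is the neighbouring stub `helper_alphaLocal`). The equation-free steps `β`, `γ`
are the landed `Apriori.beta`, `Apriori.gamma`, fed with the landed worker stubs
`stub_ladyzhenskaya`, `stub_supBound`, `stub_normIteratedFDerivLe`.

* `bootstrap_local` : the induction — on discs of radii `r t = δ/2 + δ/(2(t+2))`, each round
  `α, α, β, α, γ` turns sup bounds on the orders `≤ m + 1` into sup bounds on the orders `≤ m + 2`;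
* `helper_aprioriLocal_of` : the registered stub — choice of the scale `δ = 1/(1 + 4M(1+M))` with
  `M ≥ ‖J‖, ‖dJ‖` on the ball of radius `R₀`, and the induction read off at the centre.
-/

noncomputable section

-- the registered namespace `Summit.SmoothPoincare4.SmoothPoincare4.…` repeats a component
set_option linter.dupNamespace false

open scoped ContDiff Topology Nat
open Filter Set Metric MeasureTheory Literature.Geometry.Symplectic
open Summit.SmoothPoincare4.SmoothPoincare4.Cruxes.TameOrBrodyR4.Sketch
open Summit.SmoothPoincare4.SmoothPoincare4.Cruxes.TameOrBrodyR4.Sketch.Apriori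

namespace Summit.SmoothPoincare4.SmoothPoincare4.Theorems.WitnessCharge.PencilIncompleteness

/-- **The local bootstrapping induction** (`Apriori.bootstrap` with the local step `α` as the
hypothesis `hα` and the `J`-holomorphicity equation only on the open disc of radius `2`). With
`r t = δ/2 + δ/(2(t+2))` (radii decreasing from `3δ/4` to `δ/2`), for every `m` there is `S` with
`‖Dⁱg‖ ≤ S` on the disc of radius `r (5m)` for all `i ≤ m + 1` and all admissible `g`
(steps `α, α, β, α, γ` per round). -/
theorem bootstrap_local
    (hα : ∀ (J : EuclideanSpace ℝ (Fin 4) → EuclideanSpace ℝ (Fin 4) →L[ℝ] EuclideanSpace ℝ (Fin 4)),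
      ContDiff ℝ ∞ J → (∀ x v, J x (J x v) = -v) →
      ∀ (R₀ M₀ M₁ : ℝ), (∀ x : EuclideanSpace ℝ (Fin 4), ‖x‖ ≤ R₀ → ‖J x‖ ≤ M₀) →
        (∀ x : EuclideanSpace ℝ (Fin 4), ‖x‖ ≤ R₀ → ‖fderiv ℝ J x‖ ≤ M₁) →
      ∀ (n : ℕ), 1 ≤ n → ∀ (ρ' ρ : ℝ), 0 < ρ' → ρ' < ρ → ρ ≤ 1 →
        16 * (1 + M₀ ^ 2) * M₁ ^ 2 * ρ ^ 2 ≤ 1 → ∀ (S : ℝ),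
      ∃ C : ℝ, ∀ g : ℂ → EuclideanSpace ℝ (Fin 4), ContDiff ℝ ∞ g →
        (∀ z : ℂ, ‖z‖ < 2 → ∀ ζ : ℂ, fderiv ℝ g z (Complex.I * ζ) = J (g z) (fderiv ℝ g z ζ)) →
        (∀ z : ℂ, ‖z‖ ≤ 1 → ‖g z‖ ≤ R₀) → (∀ z : ℂ, ‖z‖ ≤ 1 → ‖fderiv ℝ g z‖ ≤ 2) →
        (∀ i, 1 ≤ i → i + 2 ≤ n → ∀ z : ℂ, ‖z‖ ≤ ρ → ‖iteratedFDeriv ℝ i g z‖ ≤ S) →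
        ∫ z in Metric.closedBall (0 : ℂ) ρ', ‖iteratedFDeriv ℝ (n + 1) g z‖ ^ 2 ≤
          C * (1 + (∫ z in Metric.closedBall (0 : ℂ) ρ, ‖iteratedFDeriv ℝ (n - 1) g z‖ ^ 4) +
            ∫ z in Metric.closedBall (0 : ℂ) ρ, ‖iteratedFDeriv ℝ n g z‖ ^ 2))
    {J : EuclideanSpace ℝ (Fin 4) → EuclideanSpace ℝ (Fin 4) →L[ℝ] EuclideanSpace ℝ (Fin 4)}
    (hJs : ContDiff ℝ ∞ J) (hJ2 : ∀ x v, J x (J x v) = -v)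
    {R₀ M₀ M₁ : ℝ} (hM₀ : ∀ x : EuclideanSpace ℝ (Fin 4), ‖x‖ ≤ R₀ → ‖J x‖ ≤ M₀)
    (hM₁ : ∀ x : EuclideanSpace ℝ (Fin 4), ‖x‖ ≤ R₀ → ‖fderiv ℝ J x‖ ≤ M₁)
    {δ : ℝ} (hδ0 : 0 < δ) (hδ1 : δ ≤ 1) (hδ : 16 * (1 + M₀ ^ 2) * M₁ ^ 2 * δ ^ 2 ≤ 1) (m : ℕ) :
    ∃ S : ℝ, ∀ g : ℂ → EuclideanSpace ℝ (Fin 4), ContDiff ℝ ∞ g →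
      (∀ z : ℂ, ‖z‖ < 2 → ∀ ζ : ℂ, fderiv ℝ g z (Complex.I * ζ) = J (g z) (fderiv ℝ g z ζ)) →
      (∀ z : ℂ, ‖z‖ ≤ 1 → ‖g z‖ ≤ R₀) → (∀ z : ℂ, ‖z‖ ≤ 1 → ‖fderiv ℝ g z‖ ≤ 2) →
      ∀ i, i ≤ m + 1 → ∀ z : ℂ, ‖z‖ ≤ δ / 2 + δ / (2 * ((5 * m : ℕ) + 2)) →
        ‖iteratedFDeriv ℝ i g z‖ ≤ S := by
  -- adapted from `Apriori.bootstrap` (…TameOrBrodyR4AprioriBootstrap): `alpha ↦ hα`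
  -- the radii
  obtain ⟨r, hr⟩ : ∃ r : ℕ → ℝ, r = fun t : ℕ => δ / 2 + δ / (2 * ((t : ℝ) + 2)) := ⟨_, rfl⟩
  have hr5 : ∀ m : ℕ, r (5 * m) = δ / 2 + δ / (2 * ((5 * m : ℕ) + 2)) := fun m => by rw [hr]
  have hr_pos : ∀ t, 0 < r t := fun t => by rw [hr]; positivity
  have hr_le : ∀ t, r t ≤ δ := fun t => by
    rw [hr]
    have : δ / (2 * ((t : ℝ) + 2)) ≤ δ / 2 :=
      div_le_div_of_nonneg_left hδ0.le (by norm_num)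
        (by nlinarith [(Nat.cast_nonneg t : (0 : ℝ) ≤ t)])
    show δ / 2 + δ / (2 * ((t : ℝ) + 2)) ≤ δ
    linarith
  have hr_anti : ∀ t t' : ℕ, t ≤ t' → r t' ≤ r t := fun t t' htt => by
    rw [hr]
    have : δ / (2 * ((t' : ℝ) + 2)) ≤ δ / (2 * ((t : ℝ) + 2)) :=
      div_le_div_of_nonneg_left hδ0.le (by positivity) (by
        have : (t : ℝ) ≤ t' := by exact_mod_cast htt
        linarith)
    show δ / 2 + δ / (2 * ((t' : ℝ) + 2)) ≤ δ / 2 + δ / (2 * ((t : ℝ) + 2))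
    linarith
  have hr_lt : ∀ t : ℕ, r (t + 1) < r t := fun t => by
    rw [hr]
    have : δ / (2 * (((t + 1 : ℕ) : ℝ) + 2)) < δ / (2 * ((t : ℝ) + 2)) :=
      div_lt_div_of_pos_left hδ0 (by positivity) (by push_cast; linarith)
    show δ / 2 + δ / (2 * (((t + 1 : ℕ) : ℝ) + 2)) < δ / 2 + δ / (2 * ((t : ℝ) + 2))
    linarith
  have hr1 : ∀ t, r t ≤ 1 := fun t => (hr_le t).trans hδ1
  have hrδ : ∀ t, 16 * (1 + M₀ ^ 2) * M₁ ^ 2 * r t ^ 2 ≤ 1 := fun t => by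
    have : r t ^ 2 ≤ δ ^ 2 := pow_le_pow_left₀ (hr_pos t).le (hr_le t) 2
    have h0 : 0 ≤ 16 * (1 + M₀ ^ 2) * M₁ ^ 2 := by positivity
    nlinarith [mul_le_mul_of_nonneg_left this h0]
  -- restate the goal with `r`
  suffices H : ∃ S : ℝ, ∀ g : ℂ → EuclideanSpace ℝ (Fin 4), ContDiff ℝ ∞ g →
      (∀ z : ℂ, ‖z‖ < 2 → ∀ ζ : ℂ, fderiv ℝ g z (Complex.I * ζ) = J (g z) (fderiv ℝ g z ζ)) →
      (∀ z : ℂ, ‖z‖ ≤ 1 → ‖g z‖ ≤ R₀) → (∀ z : ℂ, ‖z‖ ≤ 1 → ‖fderiv ℝ g z‖ ≤ 2) →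
      ∀ i, i ≤ m + 1 → ∀ z : ℂ, ‖z‖ ≤ r (5 * m) → ‖iteratedFDeriv ℝ i g z‖ ≤ S by
    obtain ⟨S, hS'⟩ := H
    exact ⟨S, fun g hg hgJ hg0 hg1 i hi z hz => hS' g hg hgJ hg0 hg1 i hi z (by rw [hr5]; exact hz)⟩
  induction m with
  | zero =>
    refine ⟨max R₀ 2, fun g hg hgJ hg0 hg1 i hi z hz => ?_⟩
    have hz1 : ‖z‖ ≤ 1 := hz.trans (hr1 _)
    interval_cases i
    · rw [norm_iteratedFDeriv_zero]; exact (hg0 z hz1).trans (le_max_left _ _)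
    · rw [norm_iteratedFDeriv_one_eq]; exact (hg1 z hz1).trans (le_max_right _ _)
  | succ m ih =>
    obtain ⟨S, hSb⟩ := ih
    -- the five steps, with their `g`-independent constants
    have hn1 : 1 ≤ m + 1 := by omega
    obtain ⟨CA, hCA⟩ := hα J hJs hJ2 R₀ M₀ M₁ hM₀ hM₁ (m + 1) hn1 (r (5 * m + 1)) (r (5 * m))
      (hr_pos (5 * m + 1)) (hr_lt (5 * m)) (hr1 _) (hrδ _) S
    obtain ⟨CB, hCB⟩ := hα J hJs hJ2 R₀ M₀ M₁ hM₀ hM₁ (m + 2) (by omega) (r (5 * m + 2))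
      (r (5 * m + 1)) (hr_pos (5 * m + 2)) (hr_lt (5 * m + 1)) (hr1 _) (hrδ _) S
    obtain ⟨CC, hCC⟩ := beta stub_ladyzhenskaya stub_normIteratedFDerivLe (m + 2)
      (hr_pos (5 * m + 3)) (hr_lt (5 * m + 2))
    obtain ⟨CD, hCD⟩ := hα J hJs hJ2 R₀ M₀ M₁ hM₀ hM₁ (m + 3) (by omega) (r (5 * m + 4))
      (r (5 * m + 3)) (hr_pos (5 * m + 4)) (hr_lt (5 * m + 3)) (hr1 _) (hrδ _) S
    obtain ⟨CE, hCE⟩ := gamma stub_supBound stub_normIteratedFDerivLe (m + 2)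
      (hr_pos (5 * m + 5)) (hr_lt (5 * m + 4))
    -- volumes
    obtain ⟨V0, hV0⟩ : ∃ V : ℝ, V = (volume (closedBall (0 : ℂ) (r (5 * m)))).toReal := ⟨_, rfl⟩
    obtain ⟨V1, hV1⟩ : ∃ V : ℝ, V = (volume (closedBall (0 : ℂ) (r (5 * m + 1)))).toReal :=
      ⟨_, rfl⟩
    -- the propagated bounds
    obtain ⟨Q₁, hQ₁⟩ : ∃ Q : ℝ, Q = |CA| * (1 + V0 * (max S |R₀|) ^ 4 + V0 * S ^ 2) := ⟨_, rfl⟩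
    obtain ⟨Q₂, hQ₂⟩ : ∃ Q : ℝ, Q = |CB| * (1 + V1 * S ^ 4 + Q₁) := ⟨_, rfl⟩
    obtain ⟨P, hP⟩ : ∃ Q : ℝ, Q = |CC| * (Q₁ * (Q₂ + Q₁)) := ⟨_, rfl⟩
    obtain ⟨Q₃, hQ₃⟩ : ∃ Q : ℝ, Q = |CD| * (1 + P + Q₂) := ⟨_, rfl⟩
    refine ⟨max S (|CE| * (1 + Q₃ + Q₂ + Q₁)), fun g hg hgJ hg0 hg1 i hi z hz => ?_⟩
    have hac : ∀ k, Continuous fun z => ‖iteratedFDeriv ℝ k g z‖ := fun k =>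
      (hg.continuous_iteratedFDeriv (m := k) (by exact_mod_cast le_top)).norm
    have hnn : ∀ (k p : ℕ) (ρ : ℝ), 0 ≤ ∫ z in closedBall (0 : ℂ) ρ, ‖iteratedFDeriv ℝ k g z‖ ^ p :=
      fun k p ρ => setIntegral_norm_pow_nonneg g k p ρ
    -- sup bounds from the induction hypothesis, on the disc of radius `r (5m)` and inside
    have hsup : ∀ i, i ≤ m + 1 → ∀ t, 5 * m ≤ t → ∀ z ∈ closedBall (0 : ℂ) (r t),
        ‖iteratedFDeriv ℝ i g z‖ ≤ S := fun i hi t ht z hz =>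
      hSb g hg hgJ hg0 hg1 i hi z ((mem_closedBall_zero_iff.mp hz).trans (hr_anti _ _ ht))
    -- step A
    have hA : ∫ z in closedBall (0 : ℂ) (r (5 * m + 1)), ‖iteratedFDeriv ℝ (m + 1 + 1) g z‖ ^ 2 ≤
        Q₁ := by
      have h := hCA g hg hgJ hg0 hg1 (fun i hi1 hi2 z hz =>
        hsup i (by omega) (5 * m) le_rfl z (mem_closedBall_zero_iff.mpr hz))
      refine h.trans ?_
      rw [hQ₁]
      have i4 : ∫ z in closedBall (0 : ℂ) (r (5 * m)), ‖iteratedFDeriv ℝ (m + 1 - 1) g z‖ ^ 4 ≤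
          V0 * (max S |R₀|) ^ 4 := by
        rw [hV0]
        refine setIntegral_pow_le_of_le (hac (m + 1 - 1)) (fun z => norm_nonneg _)
          (fun z hz => ?_) 4
        rcases Nat.eq_zero_or_pos m with hm | hm
        · subst hm
          show ‖iteratedFDeriv ℝ 0 g z‖ ≤ _
          rw [norm_iteratedFDeriv_zero]
          exact ((hg0 z ((mem_closedBall_zero_iff.mp hz).trans (hr1 _))).trans
            (le_abs_self _)).trans (le_max_right _ _)
        · exact (hsup (m + 1 - 1) (by omega) (5 * m) le_rfl z hz).trans (le_max_left _ _)
      have i2 : ∫ z in closedBall (0 : ℂ) (r (5 * m)), ‖iteratedFDeriv ℝ (m + 1) g z‖ ^ 2 ≤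
          V0 * S ^ 2 := by
        rw [hV0]
        exact setIntegral_pow_le_of_le (hac _) (fun z => norm_nonneg _)
          (fun z hz => hsup (m + 1) le_rfl (5 * m) le_rfl z hz) 2
      have hx4 := hnn (m + 1 - 1) 4 (r (5 * m))
      have hx2 := hnn (m + 1) 2 (r (5 * m))
      calc CA * _ ≤ |CA| * _ := mul_le_mul_of_nonneg_right (le_abs_self _) (by linarith)
        _ ≤ _ := mul_le_mul_of_nonneg_left (by linarith) (abs_nonneg _)
    have hQ₁0 : 0 ≤ Q₁ := (hnn _ _ _).trans hA
    -- step B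
    have hBstep : ∫ z in closedBall (0 : ℂ) (r (5 * m + 2)),
        ‖iteratedFDeriv ℝ (m + 2 + 1) g z‖ ^ 2 ≤ Q₂ := by
      have h := hCB g hg hgJ hg0 hg1 (fun i hi1 hi2 z hz =>
        hsup i (by omega) (5 * m + 1) (by omega) z (mem_closedBall_zero_iff.mpr hz))
      refine h.trans ?_
      rw [hQ₂]
      have i4 : ∫ z in closedBall (0 : ℂ) (r (5 * m + 1)), ‖iteratedFDeriv ℝ (m + 2 - 1) g z‖ ^ 4 ≤
          V1 * S ^ 4 := by
        rw [hV1]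
        exact setIntegral_pow_le_of_le (hac _) (fun z => norm_nonneg _)
          (fun z hz => hsup (m + 2 - 1) (by omega) (5 * m + 1) (by omega) z hz) 4
      have hA' : ∫ z in closedBall (0 : ℂ) (r (5 * m + 1)),
          ‖iteratedFDeriv ℝ (m + 2) g z‖ ^ 2 ≤ Q₁ := hA
      have hx4 := hnn (m + 2 - 1) 4 (r (5 * m + 1))
      have hx2 := hnn (m + 2) 2 (r (5 * m + 1))
      calc CB * _ ≤ |CB| * _ := mul_le_mul_of_nonneg_right (le_abs_self _) (by linarith)
        _ ≤ _ := mul_le_mul_of_nonneg_left (by linarith) (abs_nonneg _)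
    have hQ₂0 : 0 ≤ Q₂ := (hnn _ _ _).trans hBstep
    -- step C
    have hA2 : ∫ z in closedBall (0 : ℂ) (r (5 * m + 2)), ‖iteratedFDeriv ℝ (m + 2) g z‖ ^ 2 ≤ Q₁ :=
      (setIntegral_closedBall_mono ((hac (m + 2)).pow 2) (fun z => pow_nonneg (norm_nonneg _) 2)
        (hr_lt _).le).trans hA
    have hB2 : ∫ z in closedBall (0 : ℂ) (r (5 * m + 2)), ‖iteratedFDeriv ℝ (m + 2 + 1) g z‖ ^ 2 ≤
        Q₂ := hBstep
    have hCstep : ∫ z in closedBall (0 : ℂ) (r (5 * m + 3)), ‖iteratedFDeriv ℝ (m + 2) g z‖ ^ 4 ≤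
        P := by
      refine (hCC g hg).trans ?_
      rw [hP]
      have hx : (∫ z in closedBall (0 : ℂ) (r (5 * m + 2)), ‖iteratedFDeriv ℝ (m + 2) g z‖ ^ 2) *
          ((∫ z in closedBall (0 : ℂ) (r (5 * m + 2)), ‖iteratedFDeriv ℝ (m + 2 + 1) g z‖ ^ 2) +
            ∫ z in closedBall (0 : ℂ) (r (5 * m + 2)), ‖iteratedFDeriv ℝ (m + 2) g z‖ ^ 2) ≤
          Q₁ * (Q₂ + Q₁) :=
        mul_le_mul hA2 (add_le_add hB2 hA2) (add_nonneg (hnn _ _ _) (hnn _ _ _)) hQ₁0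
      have hpos : 0 ≤
          (∫ z in closedBall (0 : ℂ) (r (5 * m + 2)), ‖iteratedFDeriv ℝ (m + 2) g z‖ ^ 2) *
          ((∫ z in closedBall (0 : ℂ) (r (5 * m + 2)), ‖iteratedFDeriv ℝ (m + 2 + 1) g z‖ ^ 2) +
            ∫ z in closedBall (0 : ℂ) (r (5 * m + 2)), ‖iteratedFDeriv ℝ (m + 2) g z‖ ^ 2) :=
        mul_nonneg (hnn _ _ _) (add_nonneg (hnn _ _ _) (hnn _ _ _))
      calc CC * _ ≤ |CC| * _ := mul_le_mul_of_nonneg_right (le_abs_self _) hpos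
        _ ≤ _ := mul_le_mul_of_nonneg_left hx (abs_nonneg _)
    have hP0 : 0 ≤ P := (hnn _ _ _).trans hCstep
    -- step D
    have hDstep : ∫ z in closedBall (0 : ℂ) (r (5 * m + 4)),
        ‖iteratedFDeriv ℝ (m + 3 + 1) g z‖ ^ 2 ≤ Q₃ := by
      have h := hCD g hg hgJ hg0 hg1 (fun i hi1 hi2 z hz =>
        hsup i (by omega) (5 * m + 3) (by omega) z (mem_closedBall_zero_iff.mpr hz))
      refine h.trans ?_
      rw [hQ₃]
      have hC3 : ∫ z in closedBall (0 : ℂ) (r (5 * m + 3)), ‖iteratedFDeriv ℝ (m + 3 - 1) g z‖ ^ 4 ≤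
          P := hCstep
      have hB3 : ∫ z in closedBall (0 : ℂ) (r (5 * m + 3)), ‖iteratedFDeriv ℝ (m + 3) g z‖ ^ 2 ≤
          Q₂ :=
        (setIntegral_closedBall_mono ((hac (m + 3)).pow 2) (fun z => pow_nonneg (norm_nonneg _) 2)
          (hr_lt _).le).trans hBstep
      have hx4 := hnn (m + 3 - 1) 4 (r (5 * m + 3))
      have hx2 := hnn (m + 3) 2 (r (5 * m + 3))
      calc CD * _ ≤ |CD| * _ := mul_le_mul_of_nonneg_right (le_abs_self _) (by linarith)
        _ ≤ _ := mul_le_mul_of_nonneg_left (by linarith) (abs_nonneg _)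
    -- step E
    have hEstep : ∀ z ∈ closedBall (0 : ℂ) (r (5 * m + 5)), ‖iteratedFDeriv ℝ (m + 2) g z‖ ≤
        |CE| * (1 + Q₃ + Q₂ + Q₁) := by
      intro z hz
      refine (hCE g hg z hz).trans ?_
      have hD4 : ∫ z in closedBall (0 : ℂ) (r (5 * m + 4)), ‖iteratedFDeriv ℝ (m + 2 + 2) g z‖ ^ 2 ≤
          Q₃ := hDstep
      have hB4 : ∫ z in closedBall (0 : ℂ) (r (5 * m + 4)), ‖iteratedFDeriv ℝ (m + 2 + 1) g z‖ ^ 2 ≤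
          Q₂ :=
        (setIntegral_closedBall_mono ((hac (m + 2 + 1)).pow 2)
          (fun z => pow_nonneg (norm_nonneg _) 2) (hr_anti _ _ (by omega))).trans hBstep
      have hA4 : ∫ z in closedBall (0 : ℂ) (r (5 * m + 4)), ‖iteratedFDeriv ℝ (m + 2) g z‖ ^ 2 ≤
          Q₁ :=
        (setIntegral_closedBall_mono ((hac (m + 2)).pow 2) (fun z => pow_nonneg (norm_nonneg _) 2)
          (hr_anti _ _ (by omega))).trans hA
      have hx1 := hnn (m + 2 + 2) 2 (r (5 * m + 4))
      have hx2 := hnn (m + 2 + 1) 2 (r (5 * m + 4))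
      have hx3 := hnn (m + 2) 2 (r (5 * m + 4))
      calc CE * _ ≤ |CE| * _ := mul_le_mul_of_nonneg_right (le_abs_self _) (by linarith)
        _ ≤ _ := mul_le_mul_of_nonneg_left (by linarith) (abs_nonneg _)
    -- conclusion
    have e5 : 5 * (m + 1) = 5 * m + 5 := by ring
    rw [e5] at hz
    rcases Nat.lt_or_ge i (m + 2) with hlt | hge
    · exact (hsup i (by omega) (5 * m + 5) (by omega) z (mem_closedBall_zero_iff.mpr hz)).trans
        (le_max_left _ _)
    · have hi2 : i = m + 2 := by omega
      subst hi2
      exact (hEstep z (mem_closedBall_zero_iff.mpr hz)).trans (le_max_right _ _)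

/-- **Stub `helper_aprioriLocal_of` (local a priori estimate from the local step `α`;
`Apriori.bootstrap` + `stub_aprioriOf` of the `TameOrBrodyR4` chain, localised).** Assuming the
local step `α` (the neighbouring stub `helper_alphaLocal`), for every `C^∞` almost complex
structure `J` on `ℝ⁴`, every `R₀` and every order `k` there is a constant `C` such that every
`C^∞` map `g : ℂ → ℝ⁴` that is flat `J`-holomorphic on the open disc of radius `2`, with
`‖g‖ ≤ R₀` and `‖dg‖ ≤ 2` on the closed unit disc, satisfies `‖D^k g(0)‖ ≤ C`. Proof: with
`M ≥ ‖J‖, ‖dJ‖` on the ball of radius `R₀` and `δ = 1/(1 + 4M(1+M))` (so `16(1+M²)M²δ² ≤ 1`),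
the local bootstrapping induction `bootstrap_local` bounds `‖Dⁱg‖` for `i ≤ k + 1` on the disc
of radius `r(5k) ∋ 0`. -/
theorem helper_aprioriLocal_of :
    (∀ (J : EuclideanSpace ℝ (Fin 4) → EuclideanSpace ℝ (Fin 4) →L[ℝ] EuclideanSpace ℝ (Fin 4)),
      ContDiff ℝ ∞ J → (∀ x v, J x (J x v) = -v) →
    ∀ (R₀ M₀ M₁ : ℝ), (∀ x : EuclideanSpace ℝ (Fin 4), ‖x‖ ≤ R₀ → ‖J x‖ ≤ M₀) →
      (∀ x : EuclideanSpace ℝ (Fin 4), ‖x‖ ≤ R₀ → ‖fderiv ℝ J x‖ ≤ M₁) →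
    ∀ (n : ℕ), 1 ≤ n → ∀ (ρ' ρ : ℝ), 0 < ρ' → ρ' < ρ → ρ ≤ 1 →
      16 * (1 + M₀ ^ 2) * M₁ ^ 2 * ρ ^ 2 ≤ 1 → ∀ (S : ℝ),
    ∃ C : ℝ, ∀ g : ℂ → EuclideanSpace ℝ (Fin 4), ContDiff ℝ ∞ g →
      (∀ z : ℂ, ‖z‖ < 2 → ∀ ζ : ℂ, fderiv ℝ g z (Complex.I * ζ) = J (g z) (fderiv ℝ g z ζ)) →
      (∀ z : ℂ, ‖z‖ ≤ 1 → ‖g z‖ ≤ R₀) → (∀ z : ℂ, ‖z‖ ≤ 1 → ‖fderiv ℝ g z‖ ≤ 2) →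
      (∀ i, 1 ≤ i → i + 2 ≤ n → ∀ z : ℂ, ‖z‖ ≤ ρ → ‖iteratedFDeriv ℝ i g z‖ ≤ S) →
      ∫ z in Metric.closedBall (0 : ℂ) ρ', ‖iteratedFDeriv ℝ (n + 1) g z‖ ^ 2 ≤
        C * (1 + (∫ z in Metric.closedBall (0 : ℂ) ρ, ‖iteratedFDeriv ℝ (n - 1) g z‖ ^ 4) +
          ∫ z in Metric.closedBall (0 : ℂ) ρ, ‖iteratedFDeriv ℝ n g z‖ ^ 2)) →
    ∀ (J : EuclideanSpace ℝ (Fin 4) → EuclideanSpace ℝ (Fin 4) →L[ℝ] EuclideanSpace ℝ (Fin 4)),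
      ContDiff ℝ ∞ J → (∀ x v, J x (J x v) = -v) → ∀ (R₀ : ℝ) (k : ℕ),
    ∃ C : ℝ, ∀ g : ℂ → EuclideanSpace ℝ (Fin 4), ContDiff ℝ ∞ g →
      (∀ z : ℂ, ‖z‖ < 2 → ∀ ζ : ℂ, fderiv ℝ g z (Complex.I * ζ) = J (g z) (fderiv ℝ g z ζ)) →
      (∀ z : ℂ, ‖z‖ ≤ 1 → ‖g z‖ ≤ R₀) → (∀ z : ℂ, ‖z‖ ≤ 1 → ‖fderiv ℝ g z‖ ≤ 2) →
      ‖iteratedFDeriv ℝ k g 0‖ ≤ C := by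
  intro hα J hJs hJ2 R₀ k
  -- adapted from `stub_aprioriOf` (…TameOrBrodyR4StubAprioriOf): `bootstrap ↦ bootstrap_local`
  -- degenerate case `R₀ < 0`
  rcases lt_or_ge R₀ 0 with hR | hR
  · refine ⟨0, fun g _ _ hg0 _ => ?_⟩
    exact absurd ((norm_nonneg (g 0)).trans (hg0 0 (by simp))) (not_le.mpr hR)
  -- bounds for `J` and `dJ` on the ball of radius `R₀`
  obtain ⟨M, hM⟩ := exists_bound_iteratedFDeriv hJs R₀ 1
  have hM₀ : ∀ x : EuclideanSpace ℝ (Fin 4), ‖x‖ ≤ R₀ → ‖J x‖ ≤ M := fun x hx => by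
    have h := hM 0 (Nat.zero_le _) x hx
    rwa [norm_iteratedFDeriv_zero] at h
  have hM₁ : ∀ x : EuclideanSpace ℝ (Fin 4), ‖x‖ ≤ R₀ → ‖fderiv ℝ J x‖ ≤ M := fun x hx => by
    have h := hM 1 le_rfl x hx
    rwa [← norm_iteratedFDeriv_fderiv, norm_iteratedFDeriv_zero] at h
  have hMnn : 0 ≤ M := (norm_nonneg _).trans (hM₀ 0 (by simpa using hR))
  -- the scale `δ`
  obtain ⟨δ, hδdef⟩ : ∃ δ : ℝ, δ = 1 / (1 + 4 * M * (1 + M)) := ⟨_, rfl⟩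
  have hD : 1 ≤ 1 + 4 * M * (1 + M) := by nlinarith
  have hδ0 : 0 < δ := by rw [hδdef]; positivity
  have hδ1 : δ ≤ 1 := by rw [hδdef]; exact div_le_one_of_le₀ hD (by positivity)
  have hδ : 16 * (1 + M ^ 2) * M ^ 2 * δ ^ 2 ≤ 1 := by
    have hx : 4 * M * (1 + M) * δ ≤ 1 := by
      rw [hδdef, mul_one_div]
      exact div_le_one_of_le₀ (by linarith) (by positivity)
    have hx0 : 0 ≤ 4 * M * (1 + M) * δ := by positivity
    have hsq : (4 * M * (1 + M) * δ) ^ 2 ≤ 1 := by nlinarith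
    have hcmp : 16 * (1 + M ^ 2) * M ^ 2 * δ ^ 2 ≤ (4 * M * (1 + M) * δ) ^ 2 := by
      have : 1 + M ^ 2 ≤ (1 + M) ^ 2 := by nlinarith
      have h0 : 0 ≤ 16 * M ^ 2 * δ ^ 2 := by positivity
      nlinarith [mul_le_mul_of_nonneg_left this h0]
    exact hcmp.trans hsq
  obtain ⟨S, hSb⟩ := bootstrap_local hα hJs hJ2 hM₀ hM₁ hδ0 hδ1 hδ k
  refine ⟨S, fun g hg hgJ hg0 hg1 => hSb g hg hgJ hg0 hg1 k (Nat.le_succ k) 0 ?_⟩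
  rw [norm_zero]
  positivity

end Summit.SmoothPoincare4.SmoothPoincare4.Theorems.WitnessCharge.PencilIncompleteness
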